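import Summits.QuantumFields.YangMills.Theorems.BalabanUVNodesN15KingModelSlicesOneCarrier
import Summits.QuantumFields.YangMills.Theorems.BalabanUVNodesN15KingModelFullPropagatorTorusWalk
import HarnessLib

/-!
# BalabanUVNodes ∕ N15 — THE KING-MODEL RUNG, CURVED EDITION (PART Ρ-b): PROPOSITION 3.7's HÖLDER CLAUSE (3.65)₁ FOR KING's GENUINE SLICES ON ONE
# CARRIER — `|x−y|^{−α}|𝒢_j(x, z) − 𝒢_j(y, z)| ≤ C·(L^j)^{−α}·e^{−δ₀ min(|x−z|, |y−z|)∕L^j}` for EVERY `α ∈ (0, 1]` with ONE `(C, δ₀)` (size + gradient ⇒ Hölder,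
# by the torus coordinate walk), uniformly in the level, the volume and the mass
# (Track A, DAG node N15 = NE2; FAN-OUT v1.1 §N15 s3 «KING-MODEL RUNG … + the one-line statement of what the curved case adds»)

HONEST FRAMING.  Count-neutral kernel bookkeeping (cell `pub-ymgap`, seat `pub-ymgap-dag-n15-e` g17; `--supports stmt-QuantumFields-27366 --as helper` =
K3⁸ `SpineGivenEndpointR13SepCoPHV`).  TEMPLATE LITERATURE, `A = 0`: C. King's scalar U(1)-Higgs MODEL on finite tori ([King1986] Prop. 3.7 (3.63)–(3.65)
p. 663), NOT Bałaban's covariant objects; NE2⁺ is NOT PRINTED for those and not proved; NOT a node discharge; nothing continuum ∕ ℝ⁴ ∕ OS ∕ mass-gap ∕ Clay.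
0 `sorry`, 0 `def`, standard axioms.

THE POINT.  (3.65) prints, for the slice `G_(j)`, `|(∂_α(x, y)G^η_{(j)})(z)| ≤ C(L^jη)^{2−d−α}exp[−δ₀(L^jη)^{−1}dist({x, y}, z)]` with `∂_α(x, y)f = (f(x) − f(y))∕|x − y|^α`
(King's (3.62)).  At ONE lattice spacing the VALUE clause follows from the two sup clauses (3.63) with a constant UNIFORM in `α ∈ (0, 1]`: inside the ball
`|x − y| ≤ L^jη` walk from `y` to `x` along the coordinates (part T `abs_sub_le_of_ball_steps`: `d+1` arcs, each `≤ |x − y|` steps, every visited point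
within `|x − y|` of `x`, so the gradient's weight `e^{−δ|w−z|∕ℓ}` costs one `e^{δ}`), outside it add the two sizes; `(ρ∕ℓ)¹ ≤ (ρ∕ℓ)^α` inside and `1 ≤ (ρ∕ℓ)^α`
outside.  §1 proves this ONCE on any torus `Π_μ ℤ∕K_μ` (`holder_of_size_and_step`); §2 applies it to part Ρ-a's slices on the carrier (`kingSliceG_abs_le` = size,
`kingSliceDG_abs_le` = `L^j`·step).  The GRADIENT Hölder clause (3.65)₂ is NOT α-uniform in the model (the tree's letter
`King1986/MinimizerHolderDecayUniform.holder_dkernel_decay_blocks_unif` has `C = C(α)`, `δ = (1−α)∕(1+α)·δ₀`; `∇ℋ_j` is log-Lipschitz at block edges —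
a located schema point on the cell's literature bus) and is left to a per-`α` sequel.
* §1 ★ **`holder_of_size_and_step`** — on `Tor K`: if `|F(w)| ≤ S·e^{−δ|w−z|∕ℓ}` and `|F(w + e_μ) − F(w)| ≤ (S∕ℓ)·e^{−δ|w−z|∕ℓ}` for all `w, μ` (`S, δ ≥ 0`, `ℓ > 0`),
  then for all `x ≠ y` and EVERY `0 < α ≤ 1`: `|F(x) − F(y)| ≤ (d+3)·e^{δ}·S·(|x−y|∕ℓ)^α·e^{−δ·min(|x−z|, |y−z|)∕ℓ}`;
* §2 ★★ **`kingSliceG_holder_le`** — (3.65)₁ for King's genuine slices on the carrier, lattice units: ONE `(C, δ₀)` with, for every mass `0 < m² ≤ m₀²`, level,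
  volume, index on the carrier, `0 < α ≤ 1` and fine points `x ≠ y`, `z`:
  `|𝒢_j(x, z) − 𝒢_j(y, z)| ≤ C·(|x−y|_{T_η}∕L^j)^α·e^{−δ₀·min(|x−z|, |y−z|)∕L^j}`.
WHAT THE CURVED CASE ADDS (one line): (3.65) for `G(Ω, A)`, regular `A ≠ 0`, `Ω ⊊ T_η` — [King1986]∕[Ba 4]'s content; and the α-uniform GRADIENT clause is not
the model's (above).
HONEST SCOPE.  (i) `A = 0`, periodic b.c., odd `L ≥ 3`, slices `1 ≤ j`, `0 < m² ≤ m₀²`; (ii) lattice units of the scale-`j` lattice: the schema's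
`(L^jη)^{2−d−α}·|x−y|_{cont}^{α}`-bookkeeping is `(L^jη)^{2−d}·((|x−y|_{T_η}∕L^k)∕(L^j∕L^k))^α` = the display here times King's normalisation (the by-name file's);
(iii) not Bałaban's `G(Ω, A)`; not a discharge.
Locators: [King1986] (3.62) p.663, Prop. 3.7 (3.63)–(3.65) p.663, Theorem 3.3 (3.8) p.656.
-/

noncomputable section

namespace Summit.QuantumFields.YangMills.BalabanUVNodes.N15KingModelRung.Curved

open Real Finset Matrix
open Literature.MathematicalPhysics.QuantumFieldTheory.Balaban1983to89.B5Prop11Plancherel (Tor fine unitVec)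
open Literature.MathematicalPhysics.QuantumFieldTheory.King1986 (aK aK_pos aK_le)
open Literature.MathematicalPhysics.QuantumFieldTheory.King1986.Torus (blockOf tdistT tdistT_nonneg tdistT_triangle tdistT_symm torCongr)

variable {d : ℕ}

/-! ## §1 Size + gradient ⇒ Hölder, uniformly in the exponent, on any torus -/

/-- ★ **SIZE + GRADIENT ⇒ HÖLDER, UNIFORMLY IN `α ∈ (0, 1]`**: on the torus `Π_μ ℤ∕K_μ` (dimension `d + 1`), let `F` satisfy `|F(w)| ≤ S·e^{−δ|w−z|∕ℓ}` and
`|F(w + e_μ) − F(w)| ≤ (S∕ℓ)·e^{−δ|w−z|∕ℓ}` for all `w, μ` (`S, δ ≥ 0`, a length `ℓ > 0`, a centre `z`).  Then for all `x, y` with `|x − y| > 0` and every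
`0 < α ≤ 1`: `|F(x) − F(y)| ≤ (d+3)·e^{δ}·S·(|x−y|∕ℓ)^α·e^{−δ·min(|x−z|, |y−z|)∕ℓ}` — the coordinate walk inside the ball `|x−y| ≤ ℓ` (part T
`abs_sub_le_of_ball_steps`), the two sizes outside. [cite: King1986, Prop. 3.7 (3.65) p.663 (mechanism at one spacing: (3.63) ⇒ (3.65)); Balaban1983RegularityDecay, Theorem (1.9) p.573] -/
theorem holder_of_size_and_step (K : Fin (d + 1) → ℕ) [∀ μ, NeZero (K μ)] (F : Tor K → ℝ) (z : Tor K) {S ℓ δ : ℝ} (hS : 0 ≤ S) (hℓ : 0 < ℓ)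
    (hδ : 0 ≤ δ) (hsize : ∀ w, |F w| ≤ S * Real.exp (-(δ * (tdistT K w z / ℓ))))
    (hstep : ∀ w (μ : Fin (d + 1)), |F (w + unitVec K μ) - F w| ≤ S / ℓ * Real.exp (-(δ * (tdistT K w z / ℓ)))) (x y : Tor K)
    (hxy : 0 < tdistT K x y) {α : ℝ} (hα0 : 0 < α) (hα1 : α ≤ 1) :
    |F x - F y| ≤ ((d : ℝ) + 3) * Real.exp δ * S * (tdistT K x y / ℓ) ^ α * Real.exp (-(δ * (min (tdistT K x z) (tdistT K y z) / ℓ))) := by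
  set ρ : ℝ := tdistT K x y with hρ
  set m : ℝ := min (tdistT K x z) (tdistT K y z) with hm
  have hρ0 : 0 ≤ ρ := tdistT_nonneg K x y
  have hmx : m ≤ tdistT K x z := min_le_left _ _
  have hmy : m ≤ tdistT K y z := min_le_right _ _
  have hE0 : 0 ≤ Real.exp (-(δ * (m / ℓ))) := Real.exp_nonneg _
  have hexp_le : ∀ {t : ℝ}, m ≤ t → Real.exp (-(δ * (t / ℓ))) ≤ Real.exp (-(δ * (m / ℓ))) := fun hmt =>
    Real.exp_le_exp.mpr (by have := div_le_div_of_nonneg_right hmt hℓ.le; nlinarith)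
  by_cases hin : ρ ≤ ℓ
  · -- inside the ball: the coordinate walk
    have hq1 : ρ / ℓ ≤ 1 := by rwa [div_le_one hℓ]
    have hq0 : 0 < ρ / ℓ := div_pos hxy hℓ
    set B : ℝ := S / ℓ * (Real.exp δ * Real.exp (-(δ * (tdistT K x z / ℓ)))) with hB
    have hB0 : 0 ≤ B := by positivity
    have hwalk := abs_sub_le_of_ball_steps K F x y hB0 (fun w hw μ _ => by
      refine (hstep w μ).trans (mul_le_mul_of_nonneg_left ?_ (by positivity))
      rw [← Real.exp_add]
      refine Real.exp_le_exp.mpr ?_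
      -- `|w − z| ≥ |x − z| − |x − w| ≥ |x − z| − ℓ`
      have h1 : tdistT K x z ≤ tdistT K x w + tdistT K w z := tdistT_triangle K x w z
      have h2 : tdistT K x w ≤ ℓ := hw.trans hin
      have h3 : (tdistT K x z - ℓ) / ℓ ≤ tdistT K w z / ℓ := div_le_div_of_nonneg_right (by linarith) hℓ.le
      have h4 : (tdistT K x z - ℓ) / ℓ = tdistT K x z / ℓ - 1 := by field_simp
      nlinarith)
    rw [abs_sub_comm] at hwalk
    -- `hwalk : |F x − F y| ≤ (d+1)·ρ·B`
    have hρα : ρ / ℓ ≤ (ρ / ℓ) ^ α := by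
      have := Real.rpow_le_rpow_of_exponent_ge hq0 hq1 hα1
      rwa [Real.rpow_one] at this
    calc |F x - F y| ≤ (d + 1 : ℕ) * ρ * B := hwalk
      _ = ((d : ℝ) + 1) * Real.exp δ * S * (ρ / ℓ) * Real.exp (-(δ * (tdistT K x z / ℓ))) := by
          rw [hB]; push_cast; field_simp
      _ ≤ ((d : ℝ) + 3) * Real.exp δ * S * (ρ / ℓ) ^ α * Real.exp (-(δ * (m / ℓ))) := by
          have hA : ((d : ℝ) + 1) * Real.exp δ * S ≤ ((d : ℝ) + 3) * Real.exp δ * S :=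
            mul_le_mul_of_nonneg_right (mul_le_mul_of_nonneg_right (by linarith) (Real.exp_nonneg _)) hS
          have hA0 : 0 ≤ ((d : ℝ) + 1) * Real.exp δ * S := by positivity
          exact mul_le_mul (mul_le_mul hA hρα hq0.le (by positivity)) (hexp_le hmx) (Real.exp_nonneg _) (by positivity)
  · -- outside the ball: the two sizes
    have hq1 : 1 ≤ ρ / ℓ := by rw [le_div_iff₀ hℓ]; linarith
    have hρα : 1 ≤ (ρ / ℓ) ^ α := Real.one_le_rpow hq1 hα0.le
    have hsum : |F x - F y| ≤ 2 * S * Real.exp (-(δ * (m / ℓ))) := by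
      calc |F x - F y| ≤ |F x| + |F y| := abs_sub _ _
        _ ≤ S * Real.exp (-(δ * (tdistT K x z / ℓ))) + S * Real.exp (-(δ * (tdistT K y z / ℓ))) := add_le_add (hsize x) (hsize y)
        _ ≤ S * Real.exp (-(δ * (m / ℓ))) + S * Real.exp (-(δ * (m / ℓ))) :=
            add_le_add (mul_le_mul_of_nonneg_left (hexp_le hmx) hS) (mul_le_mul_of_nonneg_left (hexp_le hmy) hS)
        _ = 2 * S * Real.exp (-(δ * (m / ℓ))) := by ring
    have h1e : (1 : ℝ) ≤ Real.exp δ := Real.one_le_exp hδ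
    calc |F x - F y| ≤ 2 * S * Real.exp (-(δ * (m / ℓ))) := hsum
      _ = 2 * 1 * S * 1 * Real.exp (-(δ * (m / ℓ))) := by ring
      _ ≤ ((d : ℝ) + 3) * Real.exp δ * S * (ρ / ℓ) ^ α * Real.exp (-(δ * (m / ℓ))) := by
          have hd : (2 : ℝ) ≤ (d : ℝ) + 3 := by have h0 : (0 : ℝ) ≤ d := Nat.cast_nonneg d; linarith
          exact mul_le_mul_of_nonneg_right (mul_le_mul (mul_le_mul_of_nonneg_right (mul_le_mul hd h1e zero_le_one (by positivity)) hS) hρα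
            zero_le_one (by positivity)) hE0

/-! ## §2 (3.65)₁ for King's genuine slices on the carrier -/

variable (L : ℕ) [NeZero L]

/-- ★★ **PROPOSITION 3.7 (3.65)₁ FOR KING's SLICES, EVERY `α ∈ (0, 1]` WITH ONE CONSTANT** (lattice units): there are `C, δ₀ > 0` such that for every mass
`0 < m² ≤ m₀²`, level `k`, volume, index `i` on the carrier (`h`), exponent `0 < α ≤ 1`, and fine points `x ≠ y`, `z` of `T_η`:
`|𝒢_j(x, z) − 𝒢_j(y, z)| ≤ C·(|x−y|_{T_η}∕L^j)^α·e^{−δ₀·min(|x−z|, |y−z|)∕L^j}` — §1 on part Ρ-a's size (`kingSliceG_abs_le`) and gradient (`kingSliceDG_abs_le`)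
letters. [cite: King1986, Prop. 3.7 (3.65) p.663 (first Hölder display), (3.62) p.663] -/
theorem kingSliceG_holder_le (hLodd : Odd L) (hL : 2 ≤ L) {a : ℝ} (ha : 0 < a) {m0sq : ℝ} (hm0 : 0 ≤ m0sq) :
    ∃ C δ₀ : ℝ, 0 < C ∧ 0 < δ₀ ∧ ∀ (m2 : ℝ), 0 < m2 → m2 ≤ m0sq →
      ∀ (k : ℕ) (M : Fin (d + 1) → ℕ) [∀ μ, NeZero (M μ)] (i : KSliceIdx d) (h : ∀ μ, fine (L ^ k) M μ = fine (L ^ i.j) (ksU L i) μ)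
        {α : ℝ}, 0 < α → α ≤ 1 → ∀ (x y z : Tor (fine (L ^ k) M)), 0 < tdistT (fine (L ^ k) M) x y →
        |ksSlice L a m2 i (torCongr h x) (torCongr h z) - ksSlice L a m2 i (torCongr h y) (torCongr h z)|
          ≤ C * (tdistT (fine (L ^ k) M) x y / (L : ℝ) ^ i.j) ^ α
              * Real.exp (-(δ₀ * (min (tdistT (fine (L ^ k) M) x z) (tdistT (fine (L ^ k) M) y z) / (L : ℝ) ^ i.j))) := by
  obtain ⟨C₁, δ₁, hC₁, hδ₁, H₁⟩ := kingSliceG_abs_le (d := d) L hLodd hL ha hm0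
  obtain ⟨C₂, δ₂, hC₂, hδ₂, H₂⟩ := kingSliceDG_abs_le (d := d) L hLodd hL ha hm0
  set δ : ℝ := min δ₁ δ₂ with hδdef
  have hδ : 0 < δ := lt_min hδ₁ hδ₂
  set S : ℝ := max C₁ C₂ with hSdef
  have hS : 0 < S := lt_max_of_lt_left hC₁
  refine ⟨((d : ℝ) + 3) * Real.exp δ * S, δ, by positivity, hδ, ?_⟩
  intro m2 hm hcap k M _ i h α hα0 hα1 x y z hxy
  have hL0 : (0 : ℝ) < L := by exact_mod_cast Nat.pos_of_ne_zero (NeZero.ne L)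
  have hℓ : (0 : ℝ) < (L : ℝ) ^ i.j := pow_pos hL0 _
  -- the two letters, weakened to the common `(S, δ)`, as functions of the first argument
  have hweak : ∀ {Ci δi : ℝ} (w : Tor (fine (L ^ k) M)), Ci ≤ S → δ ≤ δi →
      Ci * Real.exp (-(δi * (tdistT (fine (L ^ k) M) w z / (L : ℝ) ^ i.j))) ≤ S * Real.exp (-(δ * (tdistT (fine (L ^ k) M) w z / (L : ℝ) ^ i.j))) := by
    intro Ci δi w hCi hδi
    refine mul_le_mul hCi (Real.exp_le_exp.mpr ?_) (Real.exp_nonneg _) hS.le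
    have : 0 ≤ tdistT (fine (L ^ k) M) w z / (L : ℝ) ^ i.j := div_nonneg (tdistT_nonneg _ w z) hℓ.le
    nlinarith
  have hsize : ∀ w, |ksSlice L a m2 i (torCongr h w) (torCongr h z)| ≤ S * Real.exp (-(δ * (tdistT (fine (L ^ k) M) w z / (L : ℝ) ^ i.j))) :=
    fun w => (H₁ m2 hm hcap k M i h w z).trans (hweak w (le_max_left _ _) (min_le_left _ _))
  have hstep : ∀ w (μ : Fin (d + 1)), |ksSlice L a m2 i (torCongr h (w + unitVec (fine (L ^ k) M) μ)) (torCongr h z)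
      - ksSlice L a m2 i (torCongr h w) (torCongr h z)| ≤ S / (L : ℝ) ^ i.j * Real.exp (-(δ * (tdistT (fine (L ^ k) M) w z / (L : ℝ) ^ i.j))) := by
    intro w μ
    have h2 := (H₂ m2 hm hcap k M i h μ w z).trans (hweak w (le_max_right _ _) (min_le_right _ _))
    rw [abs_mul, Nat.cast_pow, abs_of_pos hℓ] at h2
    rw [div_mul_eq_mul_div, le_div_iff₀ hℓ, mul_comm]
    exact h2
  exact holder_of_size_and_step (fine (L ^ k) M) (fun w => ksSlice L a m2 i (torCongr h w) (torCongr h z)) z hS.le hℓ hδ.le hsize hstep x y hxy hα0 hα1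

end Summit.QuantumFields.YangMills.BalabanUVNodes.N15KingModelRung.Curved

end
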